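import Summits.ValiantsHypothesis.ValiantsHypothesis.Theorems.NewtonUnitEquationsTwoProductsPermutationTypePushForward

/-!
# Route NewtonUnitEquations — crux `TwoProducts` (stmt-ValiantsHypothesis-5906): the PERMUTATION-TYPE LAW, part R3d —
# the pencil of normalised valid weights and the COUNT (`count_of_injOn`, `permutationTypeLaw_proof`)

Part (D4) + the count of the ideator's `Lifted` toolkit: valid weights normalised by `wt ζ e₀ = −1` form one real affine pencil
(`wt_weight_div`, `pencil_param`); under injectivity of the push-forward on the lifted support the visible points of ONE instance are
strict minimal unequal moments along that pencil, so the LANDED `liftedPencilCount_bound` / `liftedPencilCount_arith`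
(`…FormalLogLinearisationLiftedPencilCountBound`, used BY NAME) bounds them: `count_of_injOn` (`#S ≤ 2^{13m}(#T+2)^2`), and
`permutationTypeLaw_proof` = the `B_m`-alphabet case via `injDeg_enum`.  Over R3c (`…PermutationTypePushForward`). [folklore]

PORT NOTE.  Theorems-side port (val-lit port pool, seat val-port-2; crit-3 RE-READ #15/#17: R3/R3♯ PASS by name; director-valiant
g12-R137 (b)) of the ideator's turnkey v3 `turnkey/NewtonUnitEquationsTwoProductsPermutationTypeLaw.lean` sha16 b74751413dcd7320
(1410 l.) = tree `Cruxes/TwoProducts/Lines/relation_ladder_turnkey_PermutationTypeLaw.lean` @237e39b34ac9, split by the 400-line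
rule into FIVE files, texts VERBATIM, cut at the author's part boundaries: (R3a) `…PermutationTypeWeightOrder.lean` = Parts A/B
(p611005; v3 l.46–346 = v1 verbatim); (R3b) `…PermutationTypeLifted.lean` = Parts B-end/C/D1 (p611551; v3 l.347–596 = v1 verbatim);
(R3c) `…PermutationTypePushForward.lean` = Parts D2/D3 (v3 l.599–909: `phi`, `piE`, `InjDeg`, the planar instance,
`minUnequal_of_visible` in its v2/v3 `Set.InjOn` form); (R3d) `…PermutationTypeCount.lean` = Part D4 + Count (v3 l.912–1125:
`pencil_param`, `count_of_injOn`, `permutationTypeLaw_proof`); (R3e) `…PermutationTypeLaw.lean` = Part G + R5 + statements (v3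
l.1127–1406: `PermType`, `msetT`, `IsBm`, `visibleCount_of_isBm`, `visibleCount_of_permType`, `visibleCount_of_mergedPermType`,
`visibleCount_of_confined_blockSmall`).  Helper mode (`--supports stmt-ValiantsHypothesis-5906 --as helper`); nothing here closes
the line's residual `ResidualLawV10`, `PlanarCellBound`, the crux `TwoProducts` or `VP ≠ VNP`; no summit statement is proved.
-/

noncomputable section

-- Sub = Summit single-conjunct layout: the duplicated namespace component is mandated by the tree.
set_option linter.dupNamespace false

namespace Summit.ValiantsHypothesis.ValiantsHypothesis.Theorems.NewtonUnitEquations.TwoProducts.PermutationType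
open scoped BigOperators
open MvPolynomial

variable {σ : Type*} [Fintype σ] [DecidableEq σ]

/-! ## Part D4: the pencil of normalised valid weights, and the count -/

section Pencil
open Summit.ValiantsHypothesis.ValiantsHypothesis.Theorems.NewtonUnitEquations.TwoProducts.FormalLogLinearisation

/-- `wt_weight_div` (R3 toolkit). [folklore] -/
theorem wt_weight_div (ξ : Fin 2 → ℝ) (r : ℝ) (e : Expo) : wt (fun k => ξ k / r) e = wt ξ e / r := by
  unfold wt; ring

/-- All weights normalised by `wt ζ e₀ = -1` lie on one affine line `β + ℝ τ` (as functionals on exponents). [folklore] -/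
theorem pencil_param (e₀ : Expo) (he₀ : e₀ ≠ 0) :
    ∃ β τ : Fin 2 → ℝ, ∀ ζ : Fin 2 → ℝ, wt ζ e₀ = -1 → ∃ c : ℝ, ∀ e : Expo, wt ζ e = wt β e + c * wt τ e := by
  set p : ℝ := ((e₀ 0 : ℕ) : ℝ) with hp
  set q : ℝ := ((e₀ 1 : ℕ) : ℝ) with hq
  have hp0 : 0 ≤ p := Nat.cast_nonneg _
  have hq0 : 0 ≤ q := Nat.cast_nonneg _
  have hpq : 0 < p + q := by
    have h : e₀ 0 ≠ 0 ∨ e₀ 1 ≠ 0 := by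
      by_contra h
      push Not at h
      exact he₀ (by ext i; fin_cases i <;> simp [h.1, h.2])
    rcases h with h | h
    · have : (1 : ℝ) ≤ p := by rw [hp]; exact_mod_cast Nat.one_le_iff_ne_zero.mpr h
      linarith
    · have : (1 : ℝ) ≤ q := by rw [hq]; exact_mod_cast Nat.one_le_iff_ne_zero.mpr h
      linarith
  have hN : 0 < p ^ 2 + q ^ 2 := by
    have : 0 < (p + q) ^ 2 := by positivity
    nlinarith [mul_nonneg hp0 hq0]
  have hpq' : p + q ≠ 0 := hpq.ne'
  have hN' : p ^ 2 + q ^ 2 ≠ 0 := hN.ne'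
  refine ⟨fun _ => -1 / (p + q), ![q, -p], fun ζ hζ => ?_⟩
  have hζ' : ζ 0 * p + ζ 1 * q = -1 := by unfold wt at hζ; rw [hp, hq]; exact hζ
  set d0 : ℝ := ζ 0 + 1 / (p + q) with hd0
  set d1 : ℝ := ζ 1 + 1 / (p + q) with hd1
  have hd : d0 * p + d1 * q = 0 := by
    rw [hd0, hd1]
    have : (ζ 0 + 1 / (p + q)) * p + (ζ 1 + 1 / (p + q)) * q = (ζ 0 * p + ζ 1 * q) + (p + q) / (p + q) := by
      field_simp
      ring
    rw [this, hζ', div_self hpq']; ring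
  set c : ℝ := (d0 * q - d1 * p) / (p ^ 2 + q ^ 2) with hc
  have hc0 : d0 = c * q := by
    rw [hc, div_mul_eq_mul_div, eq_div_iff hN']
    linear_combination p * hd
  have hc1 : d1 = -(c * p) := by
    have key : d1 * (p ^ 2 + q ^ 2) = -((d0 * q - d1 * p) * p) := by linear_combination q * hd
    have : d1 = d1 * (p ^ 2 + q ^ 2) / (p ^ 2 + q ^ 2) := by field_simp
    rw [this, key, hc]
    ring
  refine ⟨c, fun e => ?_⟩
  unfold wt
  simp only [Matrix.cons_val_zero, Matrix.cons_val_one]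
  have h0 : ζ 0 = -1 / (p + q) + c * q := by
    have : ζ 0 = d0 - 1 / (p + q) := by rw [hd0]; ring
    rw [this, hc0]; ring
  have h1 : ζ 1 = -1 / (p + q) + c * (-p) := by
    have : ζ 1 = d1 - 1 / (p + q) := by rw [hd1]; ring
    rw [this, hc1]; ring
  rw [h0, h1]; ring

end Pencil


section Count
open Summit.ValiantsHypothesis.ValiantsHypothesis.Theorems.NewtonUnitEquations.TwoProducts.FormalLogLinearisation
open Summit.ValiantsHypothesis.ValiantsHypothesis.Theorems.NewtonUnitEquations.TwoProducts.PlanarCell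

variable {m : ℕ}

/-- `tailSupport_nonempty_of_mem` (R3 toolkit). [folklore] -/
theorem tailSupport_nonempty_of_mem (u v : Fin m → MvPolynomial (Fin 2) ℂ) (l : Expo)
    (hl : l ∈ (tailDiff u v).support) : (tailSupport u v).Nonempty := by
  by_contra h
  rw [Finset.not_nonempty_iff_eq_empty] at h
  have hu : ∀ j, u j = 0 := fun j => by
    have h' := support_u_subset u v j
    rw [h, Finset.subset_empty] at h'
    exact support_eq_empty.mp h'
  have hv : ∀ j, v j = 0 := fun j => by
    have h' := support_v_subset u v j
    rw [h, Finset.subset_empty] at h'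
    exact support_eq_empty.mp h'
  apply mem_support_iff.mp hl
  unfold tailDiff
  simp [hu, hv]

/-- **The lifted count.** If the push-forward `Y_e ↦ X^e` is injective on the support of the lifted difference
`∏(1+U_j) − ∏(1+V_j)`, then GLOBALLY `#visible ≤ 2^{13m}(#T+2)^2`. [folklore] -/
theorem count_of_injOn :
    ∀ (m : ℕ) (u v : Fin m → MvPolynomial (Fin 2) ℂ), (∀ j, coeff 0 (u j) = 0) → (∀ j, coeff 0 (v j) = 0) →
    Set.InjOn (piE (enum u v)) ↑(liftG (cU u v) (cV u v)).support →
    ∀ S : Finset Expo, (∀ l ∈ S, ∃ ξ : Fin 2 → ℝ, ValidWeight u v ξ ∧ IsStrictTop ξ ↑(tailDiff u v).support l) →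
      S.card ≤ 2 ^ (13 * m) * ((tailSupport u v).card + 2) ^ 2 := by
  intro m u v hu0 hv0 hInj S hS
  rcases S.eq_empty_or_nonempty with hSe | hSne
  · simp [hSe]
  obtain ⟨l₀, hl₀⟩ := hSne
  obtain ⟨ξ₀, hval₀, htop₀⟩ := hS l₀ hl₀
  have hm : 1 ≤ m := by
    rcases Nat.eq_zero_or_pos m with h | h
    · exfalso
      subst h
      apply mem_support_iff.mp htop₀.1
      unfold tailDiff
      simp
    · exact h
  have hTne : (tailSupport u v).Nonempty := tailSupport_nonempty_of_mem u v l₀ htop₀.1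
  have hsE : 0 < sE u v := Finset.card_pos.mpr hTne
  set e₀ : Expo := enum u v ⟨0, hsE⟩ with he₀def
  have he₀ : e₀ ≠ 0 := enum_ne_zero u v hu0 hv0 _
  obtain ⟨β, τ, hpencil⟩ := pencil_param e₀ he₀
  -- choices along `S`
  have hξ : ∀ x : ↥S, ∃ ξ : Fin 2 → ℝ, ValidWeight u v ξ ∧ IsStrictTop ξ ↑(tailDiff u v).support x.1 :=
    fun x => hS x.1 x.2
  choose ξf hξval hξtop using hξ
  have hκ : ∀ x : ↥S, ∃ κ₀ : Fin (sE u v) →₀ ℕ, piE (enum u v) κ₀ = x.1 ∧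
      (∑ j, mom (cU u v j) κ₀ ≠ ∑ j, mom (cV u v j) κ₀) ∧
      ∀ κ : Fin (sE u v) →₀ ℕ, κ ≠ κ₀ → (∑ j, mom (cU u v j) κ ≠ ∑ j, mom (cV u v j) κ) →
        wt (ξf x) (piE (enum u v) κ) < wt (ξf x) (piE (enum u v) κ₀) :=
    fun x => minUnequal_of_visible u v hInj (ξf x) (hξval x) x.1 (hξtop x)
  choose κf hκπ hκne hκmin using hκ
  -- normalisation radii `r x = -wt ξ_x e₀ > 0`
  have hrpos : ∀ x : ↥S, 0 < -wt (ξf x) e₀ := fun x => by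
    linarith [wt_enum_neg u v (ξf x) (hξval x) ⟨0, hsE⟩]
  have hnorm : ∀ x : ↥S, wt (fun k => ξf x k / (-wt (ξf x) e₀)) e₀ = -1 := fun x => by
    rw [wt_weight_div]
    have hne : wt (ξf x) e₀ ≠ 0 := by linarith [hrpos x]
    rw [div_neg, div_self hne]
  have hc : ∀ x : ↥S, ∃ c : ℝ, ∀ e : Expo, wt (fun k => ξf x k / (-wt (ξf x) e₀)) e = wt β e + c * wt τ e :=
    fun x => hpencil _ (hnorm x)
  choose cf hcf using hc
  -- shift the pencil parameter to be positive on `S`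
  have hSne' : (Finset.univ : Finset ↥S).Nonempty := ⟨⟨l₀, hl₀⟩, Finset.mem_univ _⟩
  set cmin : ℝ := Finset.univ.inf' hSne' cf - 1 with hcmin
  have hcc : ∀ x : ↥S, 1 ≤ cf x - cmin := fun x => by
    have := Finset.inf'_le cf (Finset.mem_univ x)
    rw [hcmin]; linarith
  set θ₂ : Fin (sE u v) → ℝ := fun i => -wt τ (enum u v i) with hθ₂
  set θ₁ : Fin (sE u v) → ℝ := fun i => -wt β (enum u v i) + cmin * θ₂ i with hθ₁
  have hθ : ∀ (x : ↥S) (i : Fin (sE u v)),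
      θ₁ i + (cf x - cmin) * θ₂ i = -wt (ξf x) (enum u v i) / (-wt (ξf x) e₀) := fun x i => by
    have h := hcf x (enum u v i)
    rw [wt_weight_div] at h
    rw [hθ₁, hθ₂]
    simp only
    rw [neg_div, h]
    ring
  have hsumθ : ∀ (x : ↥S) (ν : Fin (sE u v) → ℕ),
      ∑ i, (θ₁ i + (cf x - cmin) * θ₂ i) * (ν i : ℝ) =
        -wt (ξf x) (piE (enum u v) (Finsupp.equivFunOnFinite.symm ν)) / (-wt (ξf x) e₀) := fun x ν => by
    rw [wt_piE]
    simp only [Finsupp.coe_equivFunOnFinite_symm]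
    rw [eq_div_iff (hrpos x).ne', Finset.sum_mul, ← Finset.sum_neg_distrib]
    have hne : wt (ξf x) e₀ ≠ 0 := by linarith [hrpos x]
    refine Finset.sum_congr rfl fun i _ => ?_
    rw [hθ x i]
    field_simp
  -- lifted points, injective on `S`
  set liftPt : ↥S → (Fin (sE u v) → ℕ) := fun x => ⇑(κf x) with hliftPt
  have hinjL : Function.Injective liftPt := by
    intro x y h
    have hκ : κf x = κf y := DFunLike.coe_injective h
    apply Subtype.ext
    rw [← hκπ x, ← hκπ y, hκ]
  -- the hypothesis of the lifted pencil count
  have hhyp : ∀ μ ∈ (Finset.univ : Finset ↥S).image liftPt,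
      (∑ j, ∏ i, cU u v j i ^ μ i) ≠ (∑ j, ∏ i, cV u v j i ^ μ i) ∧
      ∃ c : ℝ, 0 < c ∧ ∀ ν : Fin (sE u v) → ℕ, ν ≠ μ →
        (∑ j, ∏ i, cU u v j i ^ ν i) ≠ (∑ j, ∏ i, cV u v j i ^ ν i) →
          ∑ i, (θ₁ i + c * θ₂ i) * (μ i : ℝ) < ∑ i, (θ₁ i + c * θ₂ i) * (ν i : ℝ) := by
    intro μ hμ
    obtain ⟨x, -, rfl⟩ := Finset.mem_image.mp hμ
    refine ⟨?_, cf x - cmin, by linarith [hcc x], fun ν hν hneq => ?_⟩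
    · have := hκne x
      unfold mom at this
      exact this
    · have hν' : Finsupp.equivFunOnFinite.symm ν ≠ κf x := by
        intro h
        apply hν
        rw [hliftPt]
        simp only
        rw [← h, Finsupp.coe_equivFunOnFinite_symm]
      have hneq' : ∑ j, mom (cU u v j) (Finsupp.equivFunOnFinite.symm ν) ≠
          ∑ j, mom (cV u v j) (Finsupp.equivFunOnFinite.symm ν) := by
        unfold mom
        simpa only [Finsupp.coe_equivFunOnFinite_symm] using hneq
      have hlt := hκmin x _ hν' hneq'
      rw [hsumθ x, hsumθ x ν]
      have hμ' : Finsupp.equivFunOnFinite.symm (liftPt x) = κf x := by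
        rw [hliftPt]; exact Finsupp.equivFunOnFinite_symm_coe (κf x)
      rw [hμ']
      exact div_lt_div_of_pos_right (by linarith) (hrpos x)
  have hbound := liftedPencilCount_bound (cU u v) (cV u v) θ₁ θ₂ _ hhyp
  have hcardS : ((Finset.univ : Finset ↥S).image liftPt).card = S.card := by
    rw [Finset.card_image_of_injective _ hinjL, Finset.card_univ, Fintype.card_coe]
  calc S.card = ((Finset.univ : Finset ↥S).image liftPt).card := hcardS.symm
    _ ≤ 2 * (sE u v * sE u v + 1) * ((Nat.log 2 (2 * m) + 1) * (2 * m) ^ (2 * Nat.log 2 (2 * m))) := hbound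
    _ ≤ 2 ^ (13 * m) * (sE u v + 2) ^ 2 := liftedPencilCount_arith m (sE u v) hm
    _ = 2 ^ (13 * m) * ((tailSupport u v).card + 2) ^ 2 := rfl


/-- **R3 (permutation-type law via the `B_m` alphabet).** [folklore] -/
theorem permutationTypeLaw_proof :
    ∀ (m : ℕ) (u v : Fin m → MvPolynomial (Fin 2) ℂ), (∀ j, coeff 0 (u j) = 0) → (∀ j, coeff 0 (v j) = 0) →
    (∀ ν ν' : Expo →₀ ℕ, ν.support ⊆ tailSupport u v → ν'.support ⊆ tailSupport u v →
      (ν.sum fun _ k => k) ≤ m → (ν'.sum fun _ k => k) ≤ m →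
      (ν.sum fun e k => k • e) = (ν'.sum fun e k => k • e) → ν = ν') →
    ∀ S : Finset Expo, (∀ l ∈ S, ∃ ξ : Fin 2 → ℝ, ValidWeight u v ξ ∧ IsStrictTop ξ ↑(tailDiff u v).support l) →
      S.card ≤ 2 ^ (13 * m) * ((tailSupport u v).card + 2) ^ 2 :=
  fun m u v hu0 hv0 hBm S hS =>
    count_of_injOn m u v hu0 hv0 (injOn_support_liftG u v (injDeg_enum u v hBm)) S hS

end Count

end Summit.ValiantsHypothesis.ValiantsHypothesis.Theorems.NewtonUnitEquations.TwoProducts.PermutationType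

end
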